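import Summits.FinalStateConjecture.FinalStateConjecture.Theses.PhaseMixingCapture
import Summits.FinalStateConjecture.FinalStateConjecture.Theorems.NearExtremalKappaCapture.Negative.ExponentMonotonicity
import Summits.FinalStateConjecture.FinalStateConjecture.Theorems.NearExtremalKappaCapture.Negative.ParameterBox
import Summits.FinalStateConjecture.FinalStateConjecture.Theorems.PhaseMixingCaptureNearExtremalKappaCaptureBackgroundUniform
import Literature.Geometry.Lorentzian.HorizonPenetratingTeukolsky

/-!
# Strategist evidence K2 (crux stmt-FinalStateConjecture-10606 `NearExtremalKappaCapture`):
# the best TYPED SPLIT — `[Sub₁ = KappaPolynomialTeukolskySlabLaw, Sub₂ = PinnedClosingBox] → crux`,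
# kernel-checked, with the closing box's degenerate exit CLOSED by pinning the geometric exponent

Not filed (`route edit --split` NOT run): a typed OPTION for the human's ruling (STRATEGY-CENSUS.md §3,
door K2). Why it is not installed by this seat: §3.3 of the census (the box must re-do ROBUST linear theory
on perturbed near-extremal backgrounds — quasilinear top-order loss; Nash–Moser needs right inverses of
`DΦ(u)` for all `u` near `0` — so the κ-corner re-enters `Sub₂`; the split is valid logic but mislabels where
the difficulty lives, and `Sub₂` has no supplier in print or tree, exactly like the dead stubs).

What is NEW relative to the dead line `polynomial-closure` (rev 3, `Lines/polynomial_closure.lean`): there the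
box carried an EXISTENTIAL geometric exponent `γ₀` (basin `c₀ χ^{γ₀} (ΛB)^{-N}`, modulus `C₀ χ^{-γ₀}(ΛB)^N √dist`),
so `N := 0, γ₀ := max γ p` made the box a COROLLARY of the crux on the crux's range (certificate
`ClosingBoxShape`, p116924) — the composition was degenerate. Here `γ₀` is PINNED to the geometric order ONE
(the order forced by the member / truncation traps, `Negative/ThresholdTraps`, `Negative/TruncationTraps`) and the
modulus is LIPSCHITZ and κ-FREE (`C₀ (ΛB)^N · dist`; the drift then stays inside the parameter box with κ-free
constants: `C₀(ΛB)^N · c₀χ(ΛB)^{-N} = C₀c₀χ ≤ Mχ/8` once `c₀ ≤ M/(8C₀)`). A crux with unknown `∃ γ` does NOT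
give a basin of order `χ¹ × (power of Λ)` nor a Lipschitz modulus, so `PinnedClosingBox` is not implied by
the crux (no `N = 0` exit); conversely it implies nothing without `Sub₁`. Every other κ-loss must be a power
of the linear constant `Λ` and the background bound `B` — "polynomial in ⇒ polynomial out" made honest.

`NearExtremalKappaCapture_of_subs` below is sorry-free: crux exponent vector
`(s, δ, kc, γ, p, a₁') = (s, δ, kc, 1 + pN, (pN − 1)/2, (2·max a₁ a₂ + 1)/3)`.
-/

noncomputable section

set_option linter.dupNamespace false

namespace Summit.FinalStateConjecture.FinalStateConjecture.Cruxes.NearExtremalKappaCapture.Strategist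

open Literature.Geometry.Lorentzian
open Summit.FinalStateConjecture.FinalStateConjecture.Theorems.NearExtremalKappaCapture.Negative
open scoped Manifold ContDiff Topology ENNReal
open Set Filter MeasureTheory

/-! ### Sub₁ — the near-extremal LINEAR κ-law for the spin-±2 Teukolsky system (verbatim `C⁺` of the
dead line; shared in technique with the deciding crux `KappaExplicitWaveDecay`, stmt-10654, at spin 2) -/

/-- **Sub₁ = `KappaPolynomialTeukolskySlabLaw`.** There are `a₁ < 1`, `p ≥ 0` and ONE regularity `(k, w)` such
that for every mass scale `M₀ > 0` and radius `R` some `C ≥ 1` gives, for all `M ∈ [M₀/2, 2M₀]` and all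
`a₁M ≤ |a| < M`, the DHRT-format slab law `Kerr.TeukolskySlabLawOn M a M k w R (C·(1 − (a/M)²)^{−p})` on the
horizon-penetrating chart `{r > M}` of EXACT Kerr. (Linear; not implied by and not implying the crux.) -/
def KappaPolynomialTeukolskySlabLaw : Prop :=
  ∀ [Kerr.Facts], ∃ a₁ : ℝ, a₁ < 1 ∧ ∃ (p : ℝ) (k : ℕ) (w : ℝ), 0 ≤ p ∧
    ∀ M₀ : ℝ, 0 < M₀ → ∀ R : ℝ, ∃ C : ℝ, 1 ≤ C ∧ ∀ M : ℝ, M₀ / 2 ≤ M → M ≤ 2 * M₀ →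
      ∀ a : ℝ, a₁ * M ≤ |a| → Kerr.IsSubextremal M a →
        Kerr.TeukolskySlabLawOn M a M k w R (C * (1 - (a / M) ^ 2) ^ (-p))

/-- Background bound at one spin (leg (β) of the dead line; its uniform version is the LANDED theorem
`Theorems.NearExtremalKappaCapture.PolynomialClosure.stub_backgroundUniform`, p77983). -/
def BackgroundBoundAt (M a : ℝ) (n : ℕ) (R B : ℝ) : Prop :=
  ∀ x : E4, x 0 = 0 → M ≤ Kerr.radius a x → Kerr.radius a x ≤ R → ∀ j : ℕ, j ≤ n →
    ‖iteratedFDeriv ℝ j (fun q : ℝ × E4 ↦ Kerr.scalarH M q.1 q.2) (a, x)‖ ≤ B ∧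
      ∀ μ : Fin 4, ‖iteratedFDeriv ℝ j (fun q : ℝ × E4 ↦ Kerr.nullCovectorFun q.1 q.2 μ) (a, x)‖ ≤ B

/-- **Lipschitz capture at one spin** with basin radius `ρ` and Lipschitz constant `L`: the crux body at a fixed
`(M, a)` (far-complete MGHD, `C^k` convergence to a SUB-extremal Kerr) with the modulus `|M' − M| + |a' − a| ≤ L·dist`
(κ-free, linear in the distance — the law a `C¹` final-parameter map gives). -/
def LipCaptureAt [Kerr.Facts] [Kerr.SliceFacts] (s : ℕ) (δ : ℝ) (k : ℕ) {M : ℝ} (hM : 0 < M)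
    (a ρ L : ℝ) : Prop :=
  ∀ (D : InitialDataSet 𝓘(ℝ, E3) (Kerr.slice a M)) [D.metric.HasLeviCivita],
    D.IsVacuumConstraintSolution →
      InitialDataSet.dataWeightedSobolevEDist s δ D (Kerr.data M a M hM.le) < ENNReal.ofReal ρ →
        ∀ 𝒟 : VacuumCauchyDevelopment D, 𝒟.IsMaximal →
          ∃ (M' a' : ℝ) (𝒟oc : Set 𝒟.carrier), Kerr.IsSubextremal M' a' ∧ FarComplete 𝒟 ∧
            𝒟.toSpacetime.ConvergesToKerr 𝒟oc M' a' k ∧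
              |M' - M| + |a' - a| ≤
                L * (InitialDataSet.dataWeightedSobolevEDist s δ D (Kerr.data M a M hM.le)).toReal

/-! ### Sub₂ — the κ-BLIND closing box with the geometric exponent PINNED -/

/-- **Sub₂ = `PinnedClosingBox`.** For every linear regularity `(k, w)` there are `a₂ < 1` and `(s, δ, kc, N)` such
that for every `M > 0` there are `(R, n, c₀ > 0, C₀ ≥ 0)` with: for every near-extremal sub-extremal spin
`a₂M ≤ |a| < M` and all `Λ, B ≥ 1`, the spin-±2 slab law with ONE constant `Λ` at every parameter pair of the box
`|M' − M| + |a' − a| ≤ Mχ/8` and the background bound `B` give LIPSCHITZ capture at `(M, a)` with basin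
`c₀ · χ · ((ΛB)^N)⁻¹` (geometric order `χ¹` PINNED; `χ = 1 − (a/M)²`) and κ-FREE Lipschitz constant `C₀ (ΛB)^N`.
Every dynamical κ-loss is thereby booked as a power of `(Λ, B)`; the only explicit `χ` is the order-one
geometric shrinkage forced by the member / truncation traps. NOT implied by the crux (whose `γ` is existential and
whose modulus is Hölder-½); implies the crux only together with Sub₁. -/
def PinnedClosingBox : Prop :=
  ∀ [Kerr.Facts] [Kerr.SliceFacts], ∀ (k : ℕ) (w : ℝ),
    ∃ a₂ : ℝ, a₂ < 1 ∧ ∃ (s : ℕ) (δ : ℝ) (kc : ℕ) (N : ℕ), ∀ (M : ℝ) (hM : 0 < M),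
      ∃ (R : ℝ) (n : ℕ) (c₀ : ℝ), 0 < c₀ ∧ ∃ C₀ : ℝ, 0 ≤ C₀ ∧
        ∀ a : ℝ, a₂ * M ≤ |a| → Kerr.IsSubextremal M a → ∀ Λ B : ℝ, 1 ≤ Λ → 1 ≤ B →
          (∀ M' a' : ℝ, |M' - M| + |a' - a| ≤ M * (1 - (a / M) ^ 2) / 8 →
              Kerr.TeukolskySlabLawOn M' a' M' k w R Λ) →
            BackgroundBoundAt M a n R B →
              LipCaptureAt s δ kc hM a (c₀ * (1 - (a / M) ^ 2) * ((Λ * B) ^ N)⁻¹) (C₀ * (Λ * B) ^ N)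

/-! ### Real-arithmetic glue -/

/-- `(x ^ (−p)) ^ N = x ^ (−(pN))` for `x ≥ 0`. -/
theorem rpow_neg_pow_natCast {x : ℝ} (hx : 0 ≤ x) (p : ℝ) (N : ℕ) :
    (x ^ (-p)) ^ N = x ^ (-(p * N)) := by
  rw [← Real.rpow_natCast, ← Real.rpow_mul hx]
  congr 1
  ring

/-- Basin bookkeeping with the pinned exponent: `c₀ ((C₁B)^N)⁻¹ · χ^(1 + pN) = c₀ χ · ((C₁ χ^(−p) B)^N)⁻¹`. -/
theorem basin_coeff_eq_one {χ c₀ C₁ B p : ℝ} (hχ : 0 < χ) (N : ℕ) :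
    c₀ * ((C₁ * B) ^ N)⁻¹ * χ ^ (1 + p * N) = c₀ * χ * ((C₁ * χ ^ (-p) * B) ^ N)⁻¹ := by
  rw [Real.rpow_add hχ, Real.rpow_one, mul_pow, mul_pow, mul_pow, rpow_neg_pow_natCast hχ.le,
    Real.rpow_neg hχ.le (p * N)]
  have ht : χ ^ (p * N) ≠ 0 := (Real.rpow_pos_of_pos hχ _).ne'
  field_simp

/-- Lipschitz-to-Hölder at the basin scale: for `0 ≤ d < c x^γ` (`c > 0`, `x > 0`) and `L ≥ 0`,
`L·d ≤ (L √c) · x^(γ/2) · √d` (verbatim the computation of the landed `captureWith_of_linear`). -/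
theorem lip_le_holder {d c x γ L : ℝ} (hd0 : 0 ≤ d) (hc : 0 < c) (hx : 0 < x) (hL : 0 ≤ L)
    (hdlt : d < c * x ^ γ) : L * d ≤ L * √c * x ^ (γ / 2) * √d := by
  have hxg : 0 ≤ x ^ (γ / 2) := Real.rpow_nonneg hx.le _
  have hsq : (√c * x ^ (γ / 2)) ^ 2 = c * x ^ γ := by
    rw [mul_pow, Real.sq_sqrt hc.le, ← Real.rpow_natCast (x ^ (γ / 2)) 2, ← Real.rpow_mul hx.le]
    norm_num
  have hsqrt_d : √d ≤ √c * x ^ (γ / 2) := by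
    rw [← Real.sqrt_sq (mul_nonneg (Real.sqrt_nonneg _) hxg), hsq]
    exact Real.sqrt_le_sqrt hdlt.le
  have hdd : d = √d * √d := (Real.mul_self_sqrt hd0).symm
  calc L * d = L * (√d * √d) := by rw [← hdd]
    _ ≤ L * (√c * x ^ (γ / 2) * √d) :=
        mul_le_mul_of_nonneg_left (mul_le_mul_of_nonneg_right hsqrt_d (Real.sqrt_nonneg _)) hL
    _ = L * √c * x ^ (γ / 2) * √d := by ring

/-- Exponent bookkeeping of the modulus: `x^(−pN) · x^((1 + pN)/2) = x^(−((pN − 1)/2))`. -/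
theorem modulus_exponent_eq {x p : ℝ} (hx : 0 < x) (N : ℕ) :
    x ^ (-(p * N)) * x ^ ((1 + p * N) / 2) = x ^ (-((p * N - 1) / 2)) := by
  rw [← Real.rpow_add hx]
  congr 1
  ring

/-! ### The split implication (sorry-free) -/

/-- **`NearExtremalKappaCapture` from Sub₁ and Sub₂** (+ the landed background-uniformity theorem). Take
`(a₁, p, k, w)` from Sub₁, `(a₂, s, δ, kc, N)` from Sub₂ at that `(k, w)`, `a₃ := max a₁ a₂`; the crux's exponent
vector is `(s, δ, kc, 1 + pN, (pN − 1)/2, (2a₃ + 1)/3)`. For `M > 0` take `(R, n, c₀, C₀)` from Sub₂, `C₁ = C(M₀ := M, R)`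
from Sub₁, `B` from `stub_backgroundUniform`, `C₁' := C₁3^p`, basin constant `c := c₀((C₁'B)^N)⁻¹`, modulus constant
`C := C₀(C₁'B)^N √c`. At a spin `(2a₃+1)M/3 ≤ |a| < M` the box constant `Λ := C₁'χ^{−p} ≥ 1` dominates Sub₁'s constant at
every box member (landed `Negative/ParameterBox`: the box lies in `[M/2, 2M] × {a₁M' ≤ |a'| < M'}` with `χ'^{−p} ≤ 3^pχ^{−p}`),
so Sub₂ gives Lipschitz capture with basin `c₀χ(ΛB)^{−N} = cχ^{1+pN}` and constant `C₀(ΛB)^N = C₀(C₁'B)^Nχ^{−pN}`; inside the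
basin `d < cχ^{1+pN}` the Lipschitz bound is at most `C χ^{−(pN−1)/2} √d`. -/
theorem NearExtremalKappaCapture_of_subs (hL : KappaPolynomialTeukolskySlabLaw) (hT : PinnedClosingBox) :
    Theses.PhaseMixingCapture.NearExtremalKappaCapture := by
  refine near_iff.mpr ?_
  intro hF hS
  obtain ⟨a₁, ha₁, p, k, w, hp, hlaw⟩ := @hL hF
  obtain ⟨a₂, ha₂, s, δ, kc, N, hTk⟩ := @hT hF hS k w
  set a₃ : ℝ := max a₁ a₂ with ha₃
  have ha₃1 : a₃ < 1 := max_lt ha₁ ha₂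
  have ha₁₃ : a₁ ≤ a₃ := le_max_left _ _
  have ha₂₃ : a₂ ≤ a₃ := le_max_right _ _
  refine ⟨s, δ, kc, 1 + p * N, (p * N - 1) / 2, (2 * a₃ + 1) / 3, by linarith, ?_⟩
  intro M hM
  obtain ⟨R, n, c₀, hc₀, C₀, hC₀, hTM⟩ := hTk M hM
  obtain ⟨C₁, hC₁, hlawM⟩ := hlaw M hM R
  obtain ⟨B, hB1, hBM⟩ :=
    Theorems.NearExtremalKappaCapture.PolynomialClosure.stub_backgroundUniform M hM n R
  have h3p : 1 ≤ (3 : ℝ) ^ p := Real.one_le_rpow (by norm_num) hp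
  set C₁' : ℝ := C₁ * (3 : ℝ) ^ p with hC₁'
  have hC₁'1 : 1 ≤ C₁' := by rw [hC₁']; nlinarith
  have hC₁'0 : 0 < C₁' := by linarith
  have hB0 : 0 < B := by linarith
  set c : ℝ := c₀ * ((C₁' * B) ^ N)⁻¹ with hcdef
  have hc : 0 < c := by positivity
  refine ⟨c, hc, C₀ * (C₁' * B) ^ N * √c, ?_⟩
  intro a ha hsub D inst hvac hdist 𝒟 hmax
  obtain ⟨hχ0, hχ1⟩ := kappaSq_pos_le_one hsub
  set χ : ℝ := 1 - (a / M) ^ 2 with hχdef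
  -- the spin is in both ranges
  have ha13 : (2 * a₁ + 1) / 3 * M ≤ |a| := by
    have : (2 * a₁ + 1) / 3 * M ≤ (2 * a₃ + 1) / 3 * M := by
      apply mul_le_mul_of_nonneg_right _ hM.le
      linarith
    exact this.trans ha
  have ha2 : a₂ * M ≤ |a| := by
    have : a₂ * M ≤ (2 * a₃ + 1) / 3 * M := by
      apply mul_le_mul_of_nonneg_right _ hM.le
      linarith
    exact this.trans ha
  -- the box constant at this spin, `Λ = C₁' χ^{-p} ≥ 1`
  have hχp : 1 ≤ χ ^ (-p) := Real.one_le_rpow_of_pos_of_le_one_of_nonpos hχ0 hχ1 (by linarith)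
  have hΛ1 : 1 ≤ C₁' * χ ^ (-p) := by nlinarith
  -- Sub₁ on the whole box, dominated by the one constant `Λ`
  have hboxlaw : ∀ M' a' : ℝ, |M' - M| + |a' - a| ≤ M * (1 - (a / M) ^ 2) / 8 →
      Kerr.TeukolskySlabLawOn M' a' M' k w R (C₁' * χ ^ (-p)) := by
    intro M' a' hbox
    obtain ⟨hlo, hhi⟩ := box_mass_bounds hsub hbox
    have hsub' : Kerr.IsSubextremal M' a' := isSubextremal_of_box hsub hbox
    have ha' : a₁ * M' ≤ |a'| := box_spin_ge hsub hbox ha13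
    have hlaw' : Kerr.TeukolskySlabLawOn M' a' M' k w R (C₁ * (1 - (a' / M') ^ 2) ^ (-p)) :=
      hlawM M' (by linarith) (by linarith) a' ha' hsub'
    have hle : C₁ * (1 - (a' / M') ^ 2) ^ (-p) ≤ C₁' * χ ^ (-p) :=
      calc C₁ * (1 - (a' / M') ^ 2) ^ (-p) ≤ C₁ * ((3 : ℝ) ^ p * χ ^ (-p)) :=
            mul_le_mul_of_nonneg_left (rpow_neg_box_le hsub hbox hp) (by linarith)
        _ = C₁' * χ ^ (-p) := by rw [hC₁']; ring
    exact @Kerr.TeukolskySlabLawOn.mono hF M' a' M' k w R _ _ hlaw' hle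
  have haM : |a| ≤ M := le_of_lt hsub
  have hcap := hTM a ha2 hsub (C₁' * χ ^ (-p)) B hΛ1 hB1 hboxlaw (hBM a haM)
  -- the basin of Sub₂ at `Λ` is `c χ^{1 + pN}`
  have hdist' : InitialDataSet.dataWeightedSobolevEDist s δ D (Kerr.data M a M hM.le) <
      ENNReal.ofReal (c₀ * χ * ((C₁' * χ ^ (-p) * B) ^ N)⁻¹) := by
    rwa [hcdef, basin_coeff_eq_one hχ0 N] at hdist
  obtain ⟨M', a', 𝒟oc, hsub', hfar, hconv, hmod⟩ := hcap D hvac hdist' 𝒟 hmax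
  refine ⟨M', a', 𝒟oc, hsub', hfar, hconv, hmod.trans ?_⟩
  -- Lipschitz ⇒ Hölder-½ with exponent `−(pN − 1)/2` inside the basin `d < c χ^{1+pN}`
  set d : ℝ := (InitialDataSet.dataWeightedSobolevEDist s δ D (Kerr.data M a M hM.le)).toReal
    with hddef
  have hd0 : 0 ≤ d := ENNReal.toReal_nonneg
  have hdlt : d < c * χ ^ (1 + p * N) := ENNReal.toReal_lt_of_lt_ofReal hdist
  have hpow : (C₁' * χ ^ (-p) * B) ^ N = (C₁' * B) ^ N * χ ^ (-(p * N)) := by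
    rw [mul_pow, mul_pow, mul_pow, rpow_neg_pow_natCast hχ0.le]
    ring
  have hL0 : 0 ≤ C₀ * (C₁' * χ ^ (-p) * B) ^ N := by positivity
  calc C₀ * (C₁' * χ ^ (-p) * B) ^ N * d
      ≤ C₀ * (C₁' * χ ^ (-p) * B) ^ N * √c * χ ^ ((1 + p * N) / 2) * √d :=
        lip_le_holder hd0 hc hχ0 hL0 hdlt
    _ = C₀ * (C₁' * B) ^ N * √c * (χ ^ (-(p * N)) * χ ^ ((1 + p * N) / 2)) * √d := by
        rw [hpow]; ring
    _ = C₀ * (C₁' * B) ^ N * √c * χ ^ (-((p * N - 1) / 2)) * √d := by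
        rw [modulus_exponent_eq hχ0 N]

/-- Wiring check: the split theorem has exactly the protocol's shape `Sub₁ → Sub₂ → <CruxDecl>`. -/
example : KappaPolynomialTeukolskySlabLaw → PinnedClosingBox →
    Theses.PhaseMixingCapture.NearExtremalKappaCapture :=
  NearExtremalKappaCapture_of_subs

end Summit.FinalStateConjecture.FinalStateConjecture.Cruxes.NearExtremalKappaCapture.Strategist

end
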